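import Mathlib.MeasureTheory.Integral.Lebesgue.Add
import Mathlib.Analysis.SpecialFunctions.Log.Basic
import HarnessLib

/-!
# Route `BECRieszReverseHolder`, crux `CoarseGrainedReverseHolder`
# (stmt-AtomisticToContinuum-12840), line `registered`: stub `stub_lintegral_ofReal_le_of_tangent`

Supports (does not close) stmt-AtomisticToContinuum-12840; stub
`stub_lintegral_ofReal_le_of_tangent` of the line `registered`
(`Cruxes/CoarseGrainedReverseHolder/Lines/registered.lean`).

**Tangent-line Jensen for the concave logarithm, in `[0,∞]`-valued lower integrals.** Let `w, g ≥ 0`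
with `∫⁻ ofReal w ≤ 1` (a sub-probability density) and `∫⁻ ofReal g ≤ ofReal C`, and let `f` satisfy
a.e. `f ≤ w log (g / w)` on `{w > 0}` and `f ≤ 0` on `{w = 0}`. Then

`∫⁻ ofReal f ≤ ofReal (log (max C 1) + 1)`.

In the lead's composition `Y` is the environment, `w(Y)` the slice mass, `g/w` the Rényi-2 cube
functional and `f` the coarse conditional entropy integrand after the finite Jensen step; working with
lower integrals means no integrability of `f` is needed.

Proof (elementary, Mathlib only). Put `t := max C 1 ≥ 1`. Pointwise a.e.,
`f ≤ g / t + w log t`: trivial when `w = 0` or `g = 0` (then `f ≤ 0`), and for `w, g > 0`,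
`log (g/w) = log (g/(w t)) + log t ≤ g/(w t) - 1 + log t` (tangent line `log u ≤ u - 1`), so
`w log (g/w) ≤ g/t - w + w log t ≤ g/t + w log t`. Pass to `ofReal`, integrate (`lintegral_mono_ae`),
split the sum (`lintegral_add_left'`, this is where a.e.-measurability of `g` is used), pull the
constants out, and bound `(∫⁻ ofReal g) · ofReal t⁻¹ ≤ ofReal (C / t) ≤ 1` and
`(∫⁻ ofReal w) · ofReal (log t) ≤ ofReal (log t)`.

## References

* R. Durrett, *Probability: Theory and Examples* (2019), Jensen's inequality (Thm 1.6.2); here in the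
  tangent-line form for the concave `log`.
* Mathlib `Real.log_le_sub_one_of_pos`, `Real.log_mul`, `MeasureTheory.lintegral_mono_ae`,
  `MeasureTheory.lintegral_add_left'`, `MeasureTheory.lintegral_mul_const''`.
-/

open MeasureTheory
open scoped ENNReal

namespace Summit.AtomisticToContinuum.BoseEinsteinCondensation.Theorems.CoarseGrainedReverseHolder

/-- **Pointwise tangent-line bound.** For `t ≥ 1`, `w, g ≥ 0`, if `f ≤ w log (g / w)` whenever `w > 0`
and `f ≤ 0` whenever `w = 0`, then `f ≤ g / t + w log t`. -/
theorem le_div_add_mul_log_of_tangent {f w g t : ℝ} (ht : 1 ≤ t) (hw : 0 ≤ w) (hg : 0 ≤ g)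
    (h₁ : 0 < w → f ≤ w * Real.log (g / w)) (h₂ : w = 0 → f ≤ 0) :
    f ≤ g / t + w * Real.log t := by
  have ht0 : 0 < t := lt_of_lt_of_le one_pos ht
  have hlogt : 0 ≤ Real.log t := Real.log_nonneg ht
  have hA : 0 ≤ g / t := div_nonneg hg ht0.le
  have hB : 0 ≤ w * Real.log t := mul_nonneg hw hlogt
  rcases hw.eq_or_lt with hw0 | hwpos
  · have hf0 : f ≤ 0 := h₂ hw0.symm
    linarith
  · have hfw : f ≤ w * Real.log (g / w) := h₁ hwpos
    rcases hg.eq_or_lt with hg0 | hgpos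
    · have hlog0 : Real.log (g / w) = 0 := by rw [← hg0, zero_div, Real.log_zero]
      rw [hlog0, mul_zero] at hfw
      linarith
    · have hwne : w ≠ 0 := hwpos.ne'
      have hu : 0 < g / (w * t) := div_pos hgpos (mul_pos hwpos ht0)
      have hlog : Real.log (g / w) = Real.log (g / (w * t)) + Real.log t := by
        rw [← Real.log_mul hu.ne' ht0.ne', div_mul_eq_mul_div, mul_div_mul_right _ _ ht0.ne']
      have hle : Real.log (g / (w * t)) ≤ g / (w * t) - 1 := Real.log_le_sub_one_of_pos hu
      calc f ≤ w * Real.log (g / w) := hfw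
        _ = w * Real.log (g / (w * t)) + w * Real.log t := by rw [hlog, mul_add]
        _ ≤ w * (g / (w * t) - 1) + w * Real.log t :=
            add_le_add (mul_le_mul_of_nonneg_left hle hw) le_rfl
        _ = g / t - w + w * Real.log t := by
            rw [mul_sub, mul_one, mul_div_assoc', mul_div_mul_left _ _ hwne]
        _ ≤ g / t + w * Real.log t := by linarith
/-- **Tangent-line Jensen in lower integrals.** If `w, g ≥ 0`, `g` is a.e.-measurable,
a.e. `f ≤ w log (g / w)` on `{w > 0}` and `f ≤ 0` on `{w = 0}`, `∫⁻ ofReal w ≤ 1` and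
`∫⁻ ofReal g ≤ ofReal C`, then `∫⁻ ofReal f ≤ ofReal (log (max C 1) + 1)`. -/
theorem stub_lintegral_ofReal_le_of_tangent {α : Type*} [MeasurableSpace α] {μ : Measure α}
    {f w g : α → ℝ} {C : ℝ} (hw : ∀ Y, 0 ≤ w Y) (hg : ∀ Y, 0 ≤ g Y) (hgm : AEMeasurable g μ)
    (hf : ∀ᵐ Y ∂μ, (0 < w Y → f Y ≤ w Y * Real.log (g Y / w Y)) ∧ (w Y = 0 → f Y ≤ 0))
    (hwint : ∫⁻ Y, ENNReal.ofReal (w Y) ∂μ ≤ 1)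
    (hgint : ∫⁻ Y, ENNReal.ofReal (g Y) ∂μ ≤ ENNReal.ofReal C) :
    ∫⁻ Y, ENNReal.ofReal (f Y) ∂μ ≤ ENNReal.ofReal (Real.log (max C 1) + 1) := by
  set t : ℝ := max C 1
  have ht1 : 1 ≤ t := le_max_right _ _
  have ht0 : 0 < t := lt_of_lt_of_le one_pos ht1
  have hCt : C ≤ t := le_max_left _ _
  have hlogt : 0 ≤ Real.log t := Real.log_nonneg ht1
  -- (1)-(2): the a.e. pointwise tangent-line bound, transported to `ℝ≥0∞`.
  have hae : ∀ᵐ Y ∂μ, ENNReal.ofReal (f Y) ≤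
      ENNReal.ofReal (g Y) * ENNReal.ofReal t⁻¹ +
        ENNReal.ofReal (w Y) * ENNReal.ofReal (Real.log t) := by
    filter_upwards [hf] with Y hY
    have hpt : f Y ≤ g Y / t + w Y * Real.log t :=
      le_div_add_mul_log_of_tangent ht1 (hw Y) (hg Y) hY.1 hY.2
    calc ENNReal.ofReal (f Y) ≤ ENNReal.ofReal (g Y / t + w Y * Real.log t) :=
          ENNReal.ofReal_le_ofReal hpt
      _ = ENNReal.ofReal (g Y) * ENNReal.ofReal t⁻¹ +
            ENNReal.ofReal (w Y) * ENNReal.ofReal (Real.log t) := by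
          rw [ENNReal.ofReal_add (div_nonneg (hg Y) ht0.le) (mul_nonneg (hw Y) hlogt),
            div_eq_mul_inv, ENNReal.ofReal_mul (hg Y), ENNReal.ofReal_mul (hw Y)]
  -- (3)-(4): integrate, split, pull out the constants and bound.
  have hCt' : ENNReal.ofReal C * ENNReal.ofReal t⁻¹ ≤ 1 := by
    rw [← ENNReal.ofReal_mul' (inv_nonneg.mpr ht0.le), ← div_eq_mul_inv]
    exact ENNReal.ofReal_le_one.mpr ((div_le_one ht0).mpr hCt)
  calc ∫⁻ Y, ENNReal.ofReal (f Y) ∂μ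
      ≤ ∫⁻ Y, (ENNReal.ofReal (g Y) * ENNReal.ofReal t⁻¹ +
          ENNReal.ofReal (w Y) * ENNReal.ofReal (Real.log t)) ∂μ := lintegral_mono_ae hae
    _ = (∫⁻ Y, ENNReal.ofReal (g Y) ∂μ) * ENNReal.ofReal t⁻¹ +
          (∫⁻ Y, ENNReal.ofReal (w Y) ∂μ) * ENNReal.ofReal (Real.log t) := by
        rw [lintegral_add_left' (hgm.ennreal_ofReal.mul_const _),
          lintegral_mul_const'' _ hgm.ennreal_ofReal,
          lintegral_mul_const' _ _ ENNReal.ofReal_ne_top]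
    _ ≤ ENNReal.ofReal C * ENNReal.ofReal t⁻¹ + 1 * ENNReal.ofReal (Real.log t) := by
        gcongr
    _ ≤ 1 + 1 * ENNReal.ofReal (Real.log t) := add_le_add hCt' le_rfl
    _ = ENNReal.ofReal (Real.log t + 1) := by
        rw [one_mul, ENNReal.ofReal_add hlogt zero_le_one, ENNReal.ofReal_one, add_comm]

end Summit.AtomisticToContinuum.BoseEinsteinCondensation.Theorems.CoarseGrainedReverseHolder
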